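import Literature.MathematicalPhysics.QuantumFieldTheory.Federbush1986.PrintedModeNoExponentialDecay
import Literature.MathematicalPhysics.QuantumFieldTheory.Federbush1986.ModeAnalyticityGaugeRepair

/-!
# Federbush–Williamson, *A phase cell approach to Yang–Mills theory. II. Analysis of a mode* (J. Math. Phys. **28** (1987)
# 1416–1419) [FederbushWilliamson1987PhaseCellII] — Theorem 3.1 p. 1417 is FALSE AS TYPED FOR EVERY COMPONENT `i`: each
# `A^N_i(p)` of (2.4) has a pole along the light cone through `p = 0`; hence [Federbush1986PhaseCellI] (3.13) p. 328 fails for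
# print's `A^N`, every `μ`

statement-level skeleton of published theorems with citation tags; proofs where landed; nothing here is a claim about the
Yang–Mills mass gap

CITATION HEADER.  P. Federbush, C. Williamson, *II. Analysis of a mode*, J. Math. Phys. **28** (1987) 1416–1419
[FederbushWilliamson1987PhaseCellII]: (2.1) «A′_i = (−r_L f̄₁⁻¹ (1/p²)) (1/p_i) (16/𝒟) l_i», (2.2)–(2.3) «l_i = −∏_{j≠1,i} ⟨1/p_j²⟩,
i ≠ 1», (2.4) «A^N_i(p) = A′_i(p) + p_iX(p)», (2.5), Theorem 3.1 p. 1417 «There is an ε₀ > 0 such that in the domain, 𝒟_L, …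
A^N_i(p) is analytic.»; (5.3)–(5.4), (6.11)–(6.14) p. 1418.  P. Federbush, *I. Modes, lattice-continuum duality*, Commun. Math.
Phys. **107** (1986) 319–329 [Federbush1986PhaseCellI], (3.13) p. 328 «|A^N_μ(x)| < c e^{−γ|x|}» (v1.1 DOCFIX, referee DF-g52-1 of
ref-5 gen 52: v1 printed here the paraphrase «|A(x)| ≤ c e^{−|x|/c}» inside quotation marks; print — render `fedI` p010 — has the
component index μ, the strict `<` and the rate γ; declarations untouched).  PDF of II held: Deep-Blue scan
`run/shared/lean/pub/pub-balaban/t4/b2b-balaban-t4-lit2/pdf/fedwill1987-jmp28-II.pdf` (page renders `…/g7/fw1987II/`).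
Unit `lit-balaban-r17` gen 13 (Federbush fold owner; HOME `run/shared/lean/pub/lit-balaban/lit-balaban-r17/`); SKELETON rows
**F2.Thm3.1 / F2.Thm3.2 / F2.Thm3.3 / F2.Thms** and **F1.Eq3.13-3.15** of `SKELETON-r17.md`.

WHAT IS DECIDED.  p04 gen 5 (`ModeAnalyticityThm31Refutation`, p250244) refuted r17's typed reading `ModeAnalyticity.Theorem31 s i`
for the LONGITUDINAL component `i = 1` (Lean index `0`, the bond direction): `A^N_1` admits no holomorphic extension to any ball
about `p = 0` (`no_holomorphic_extension`).  This module removes the restriction to one component: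
**`no_holomorphic_extension_all (s) (i : Fin 4)`** — for every `s` and EVERY component `i`, no function holomorphic on a ball
`‖p‖ < ρ ≤ 1/2` agrees with `ModeAnalyticity.AN s i` at the real generic momenta of that ball; hence **`not_theorem31_all`,
`not_theorem32_all`, `not_theorem33_all (s) (i)`**; and, with r17 gen 13's converse Paley–Wiener step
(`PrintedModeNoDecay.differentiableOn_laplaceFT`, p329890), **`no_decaying_field_with_printed_transform_all`** /
**`not_decay313_of_printed_transform_all (s) (μ)`**: no continuous exponentially decaying field — in particular no field with the
typed package `AbelianAveraging.Decay313to315` — has a component whose Fourier–Laplace transform (any convention `κ`, `σ`) is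
print's `A^N_μ` near `p = 0`.  So I (3.13) fails for print's `A^N` in EVERY component (the μ = 1 case was p329890); the located
repair is unchanged: p04's corrected gauge `X_c = X/(1+g)` (`ModeAnalyticityThms31to33Corrected`, `CorrectedModePlaquetteVariables`),
in which Theorems 3.1–3.3 and (3.13)–(3.15) hold for all components.

THE MATHEMATICS (print's indices).  (i) TRANSVERSE COMPONENT 2.  With (5.3) `⟨1/p_j²⟩ = r₀e_j/(p²p_j²)`
(`ModeAnalyticityBracketSplit.invSqBracket_eq`), (2.3) `l₂ = −⟨1/p₃²⟩⟨1/p₄²⟩ = −r₀²e₃e₄/((p²)²p₃²p₄²)`, (1.18)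
`𝒟 = 16r₀³·p²(1+ĝ)/((p²)³∏_jp_j²)` (`den_eq`: `Σ_kp_k²∏_{j≠k}e_j = p²(1+ĝ)`) and (5.1)–(5.2) `−r_Lf̄₁⁻¹ = Φ/p₁` (`prefactor_eq`):
`A′₂ = −Φ·p₁p₂·e₃e₄/(p²r₀(1+ĝ))`, `p₂X = Φ·p₁p₂/(p²r₀e₁(1+p²)^s)`, i.e. the cleared identity
(★₂) `Φ·p₁p₂·((1+ĝ) − e₁e₃e₄(1+p²)^s) = p²·r₀·(1+ĝ)·e₁·(1+p²)^s·A^N_2` (**`main_identity_one`**) at every point of the ball with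
all `p_j ≠ 0`, `p² ≠ 0`, `e^{ip₁} ≠ 1`, `1 + p² ≠ 0`.  If `g` is holomorphic on the ball and agrees with `A^N_2` at its real generic
points, `H⁽²⁾_g := Φ·p₁p₂·((1+ĝ) − e₁e₃e₄(1+p²)^s) − p²r₀(1+ĝ)e₁(1+p²)^s·g` (holomorphic: `ModeAnalyticityBracketSplit`) vanishes at
the real points of the small ball about `(ρ/4,ρ/4,ρ/4,ρ/4)` (p04 `real_point`), hence on it (totally real identity principle,
`AbhyankarJung.eqOn_zero_of_forall_real`), hence on the whole ball; but at the cone point `p = t(1,i,0,0)`: `p² = 0`, `e_j = 1`,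
`ĝ = t²(D₂ − D₁)`, `p₁p₂ = it²`, so `H⁽²⁾_g(tv) = i·Φ(tv)·t⁴·(D₂ − D₁)(tv)` (**`H1_pv`**) — the SAME obstruction as for component 1:
`(D₂ − D₁)(tv)/t² → ℓ = 1/360 ≠ 0` (p04 `ModeAnalyticityConeLimit.tendsto_cone`, `ell_pos`).  **`no_holomorphic_extension_one`**.
(ii) COMPONENTS 3, 4 BY SYMMETRY.  The bracket (1.4) is covariant under relabelling the four coordinates,
`⟨h⟩(p∘σ) = ⟨h∘(·∘σ)⟩(p)` (**`bracket_perm`**: reindex `n ↦ n∘σ⁻¹` in the `ℤ⁴` sum; the weight is symmetric), so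
`⟨1/p_j²⟩(p∘σ) = ⟨1/p_{σj}²⟩(p)`, and `r_L`, `p²`, `𝒟` are invariant; for the transpositions `τ₃ = (2 3)`, `τ₄ = (2 4)` fixing the
bond direction 1, `l₃(p∘τ₃) = l₂(p)`, `f̄₁`, `⟨1/p₁²⟩` are unchanged, whence **`AN_two_perm`**: `A^N_3(p∘τ₃) = A^N_2(p)` and
**`AN_three_perm`**: `A^N_4(p∘τ₄) = A^N_2(p)` (Lean indices shifted by one).  A holomorphic `g` agreeing with `A^N_3` gives
`g∘(·∘τ₃)` agreeing with `A^N_2` on the same ball (relabelling preserves the sup-norm balls and the real generic momenta) —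
**`no_holomorphic_extension_of_perm`**.  (iii) Component 1 is p04's theorem.  WHY EVERY COMPONENT: modulo `p²`,
`(1+ĝ) − e₁∏_{j≠1,i}e_j·(1+p²)^s ≡ ĝ ≡ −Σ_kp_k²D_k`, and `Σ_kp_k²D_k` is not divisible by `p²` ((6.2)/(6.12) fail: GAPS.md §G-F2-01);
the gauge term `p_iX` removes the Landau-gauge pole `1/p²` of `A′_i` only up to this non-zero remainder.

INPUTS BY NAME.  p04: `ModeAnalyticityThm31Refutation.{no_holomorphic_extension, ball_subset_U, ball_subset_DL, ball_subset_DG,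
a, ball_a_subset, real_point, pv_mem_ball, Phi_pv_ne_zero, eventually_lt}` (p250244), `ModeAnalyticityBracketSplit.{invSqBracket_eq,
den_eq, scrD_expand, prefactor_eq, E_ne_zero, one_add_ghat_ne_zero, r0_ne_zero, analyticAt_Phi, analyticAt_r0, differentiableOn_E,
differentiableOn_ghat, differentiable_csq}`, `ModeAnalyticityGaugeRepair.{l_one, l_two, l_three}` (p04 gen 6; its `Aprime_one_eq`
`A′₂ = −Φp₁p₂e₃e₄/(p²r₀(1+ĝ))` is the first half of (★₂)), `ModeAnalyticityConeLimit.{pv, csq_pv, tendsto_cone, ell_ne_zero}`,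
`Literature.Analysis.Complex.{AbhyankarJung.eqOn_zero_of_forall_real, SCV.analyticOnNhd_of_differentiableOn}`; r17:
`ModeAnalyticity.{AN, Aprime, X, l, scrD, invSqBracket, bracket, rL, fbar, csq, realGeneric, Theorem31, Theorem32, Theorem33, DL,
DG}` (typed defs, untouched), `PrintedModeNoDecay.{laplaceFT, differentiableOn_laplaceFT}` (p329890),
`AbelianAveraging.Decay313to315`.

WHAT THIS MODULE PROVIDES.  Defs with bodies: `perm` (coordinate relabelling), `τ₃`, `τ₄` (the two transpositions), `H1` (the
holomorphic combination of (★₂)).  Theorems: `main_identity_one`, `differentiableOn_H1`, `H1_eq_zero`,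
`H1_pv`, `no_holomorphic_extension_one`, `csq_perm`, `rL_perm`, `shift_perm`, `bracket_perm`, `invSqBracket_perm`, `AN_two_perm`,
`AN_three_perm`, `perm_mem_ball`, `perm_mem_realGeneric`, `no_holomorphic_extension_of_perm`, `no_holomorphic_extension_all`,
`not_theorem31_all`, `not_theorem32_all`, `not_theorem33_all`, `no_decaying_field_with_printed_transform_all`,
`not_decay313_of_printed_transform_all`.  HONEST SCOPE: the refuted statements are r17's TYPED readings (`Theorem31 s i`: an
extension analytic at every point of `𝒟_L(ε₀) ⊇ {‖p‖ < min(ε₀,1/2)}` agreeing with (2.4) at the real generic momenta; I (3.13) read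
as a statement about a field whose Fourier–Laplace transform is print's `A^N_μ`); nothing is asserted about the corrected gauge.
D-0026: no named fact, no `sorry`; axioms standard.
-/

noncomputable section

namespace Literature.MathematicalPhysics.QuantumFieldTheory.Federbush1986

namespace ModeAnalyticityThm31RefutationAll

open ModeAnalyticity ModeAnalyticityLatticeSums ModeAnalyticityConeLimit ModeAnalyticityBracketSplit
  ModeAnalyticityThm31Refutation Complex Filter Topology Finset Metric Set
open scoped BigOperators Real

/-! ## §1 The transverse component `A^N_2` (Lean index `1`): the cleared identity (★₂) -/

/-- **(★₂) — (2.1)–(2.5) for the transverse component `A^N_2`, cleared of denominators**: at every `p` of the ball with all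
`p_i ≠ 0`, `p² ≠ 0`, `e^{ip₁} ≠ 1`, `1 + p² ≠ 0` (print indices):
`Φ·p₁p₂·((1+ĝ) − e₁e₃e₄(1+p²)^s) = p²·r₀·(1+ĝ)·e₁·(1+p²)^s·A^N_2(p)`.
[cite: FederbushWilliamson1987PhaseCellII, (2.1)–(2.5) p. 1417, (5.3)–(5.4) p. 1418] -/
theorem main_identity_one (s : ℕ) {p : Momentum} (hU : p ∈ U) (hp : ∀ i, p i ≠ 0) (hc : csq p ≠ 0)
    (hf : exp (I * p 0) ≠ 1) (h1 : 1 + csq p ≠ 0) :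
    Phi p * (p 0 * p 1) * ((1 + ghat p) - E 0 p * E 2 p * E 3 p * (1 + csq p) ^ s)
      = csq p * r0 p * (1 + ghat p) * E 0 p * (1 + csq p) ^ s * AN s 1 p := by
  have hB0 := invSqBracket_eq hU hp hc 0
  have hB1 := invSqBracket_eq hU hp hc 1
  have hB2 := invSqBracket_eq hU hp hc 2
  have hB3 := invSqBracket_eq hU hp hc 3
  have hr := r0_ne_zero hU
  have hE0 := E_ne_zero hU 0; have hE1 := E_ne_zero hU 1; have hE2 := E_ne_zero hU 2; have hE3 := E_ne_zero hU 3
  have hg := one_add_ghat_ne_zero hU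
  have hden := den_eq p
  have hp0 := hp 0; have hp1 := hp 1; have hp2 := hp 2; have hp3 := hp 3
  have hcs : (1 + csq p) ^ s ≠ 0 := pow_ne_zero _ h1
  have hS : scrD p = 16 * (r0 p ^ 3 * (csq p * (1 + ghat p)) / (csq p ^ 3 * (p 0 * p 1 * p 2 * p 3) ^ 2)) := by
    rw [scrD_expand, hB0, hB1, hB2, hB3, ← hden]
    field_simp
  have hL : l 1 p = -(r0 p ^ 2 * (E 2 p * E 3 p) / (csq p ^ 2 * (p 2 * p 3) ^ 2)) := by
    rw [ModeAnalyticityGaugeRepair.l_one, hB2, hB3]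
    field_simp
  unfold AN Aprime X
  rw [hS, hL, prefactor_eq hp hf, hB0]
  field_simp
  ring

/-! ## §2 The holomorphic combination `H⁽²⁾_g` and its zeros -/

/-- (plumbing) `H⁽²⁾_g(p) = Φ·p₁p₂·((1+ĝ) − e₁e₃e₄(1+p²)^s) − p²·r₀·(1+ĝ)·e₁·(1+p²)^s·g(p)`: (★₂) with the candidate extension
`g` in place of `A^N_2`. [cite: FederbushWilliamson1987PhaseCellII, (2.1)–(2.5) p. 1417, (5.3) p. 1418] -/
def H1 (s : ℕ) (g : Momentum → ℂ) (p : Momentum) : ℂ :=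
  Phi p * (p 0 * p 1) * ((1 + ghat p) - E 0 p * E 2 p * E 3 p * (1 + csq p) ^ s)
    - csq p * r0 p * (1 + ghat p) * E 0 p * (1 + csq p) ^ s * g p

/-- `H⁽²⁾_g` is holomorphic on the ball when `g` is. [cite: FederbushWilliamson1987PhaseCellII, (6.1) p. 1418] -/
theorem differentiableOn_H1 (s : ℕ) {g : Momentum → ℂ} {ρ : ℝ} (hρ : ρ ≤ 1 / 2)
    (hg : DifferentiableOn ℂ g (ball 0 ρ)) : DifferentiableOn ℂ (H1 s g) (ball 0 ρ) := by
  have hB := ball_subset_U hρ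
  have hPhi : DifferentiableOn ℂ Phi (ball (0 : Momentum) ρ) := fun p _ =>
    (analyticAt_Phi p).differentiableAt.differentiableWithinAt
  have hr0 : DifferentiableOn ℂ r0 (ball (0 : Momentum) ρ) := fun p _ =>
    (analyticAt_r0 p).differentiableAt.differentiableWithinAt
  have hE0 := (differentiableOn_E 0).mono hB
  have hE2 := (differentiableOn_E 2).mono hB
  have hE3 := (differentiableOn_E 3).mono hB
  have hgh := differentiableOn_ghat.mono hB
  have hc : DifferentiableOn ℂ csq (ball (0 : Momentum) ρ) := differentiable_csq.differentiableOn
  have h01 : DifferentiableOn ℂ (fun p : Momentum => p 0 * p 1) (ball (0 : Momentum) ρ) :=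
    ((differentiable_apply 0).mul (differentiable_apply 1)).differentiableOn
  unfold H1
  exact ((hPhi.mul h01).mul ((hgh.const_add 1).sub (((hE0.mul hE2).mul hE3).mul ((hc.const_add 1).pow s)))).sub
    (((((hc.mul hr0).mul (hgh.const_add 1)).mul hE0).mul ((hc.const_add 1).pow s)).mul hg)

/-- At a point of the ball where (★₂) applies and `g(p) = A^N_2(p)`, `H⁽²⁾_g(p) = 0`.
[cite: FederbushWilliamson1987PhaseCellII, (2.1)–(2.5) p. 1417] -/
theorem H1_eq_zero {s : ℕ} {g : Momentum → ℂ} {p : Momentum} (hU : p ∈ U) (hp : ∀ i, p i ≠ 0) (hc : csq p ≠ 0)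
    (hf : exp (I * p 0) ≠ 1) (h1 : 1 + csq p ≠ 0) (hg : g p = AN s 1 p) : H1 s g p = 0 := by
  unfold H1
  rw [hg, ← main_identity_one s hU hp hc hf h1, sub_self]

/-- **`H⁽²⁾_g` on the cone**: at `p = t(1,i,0,0)` one has `p² = 0`, `e_j = 1`, `ĝ = t²(D₂ − D₁)`, `p₁p₂ = it²`, so
`H⁽²⁾_g(tv) = i·Φ(tv)·t⁴·(D₂ − D₁)(tv)` — independently of `g` and `s`. [cite: FederbushWilliamson1987PhaseCellII, (6.14)
p. 1418] -/
theorem H1_pv (s : ℕ) (g : Momentum → ℂ) (t : ℝ) :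
    H1 s g (pv t) = I * (Phi (pv t) * (t : ℂ) ^ 4 * (D 1 (pv t) - D 0 (pv t))) := by
  unfold H1 ghat Q0 Q1 Q2 Q3 E
  simp only [csq_pv, pv_zero, pv_one, pv_two, pv_three, zero_mul, add_zero, one_pow, mul_one, sub_zero]
  linear_combination Phi (pv t) * (t : ℂ) ^ 4 * I * (D 0 (pv t) + D 2 (pv t) + D 3 (pv t)) * I_sq

/-- **Core of the refutation, transverse component.** No function holomorphic on a ball `‖p‖ < ρ` (`0 < ρ ≤ 1/2`) agrees
with the typed mode `A^N_2 = ModeAnalyticity.AN s 1` at the real generic momenta of that ball.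
[cite: FederbushWilliamson1987PhaseCellII, Theorem 3.1 p. 1417, (2.1)–(2.5) p. 1417, (6.11)–(6.14) p. 1418] -/
theorem no_holomorphic_extension_one (s : ℕ) {ρ : ℝ} (hρ : 0 < ρ) (hρ2 : ρ ≤ 1 / 2) {g : Momentum → ℂ}
    (hg : DifferentiableOn ℂ g (ball 0 ρ))
    (hagree : ∀ p ∈ realGeneric, p ∈ ball (0 : Momentum) ρ → g p = AN s 1 p) : False := by
  have hBU : ball (0 : Momentum) ρ ⊆ U := ball_subset_U hρ2
  have hH : DifferentiableOn ℂ (H1 s g) (ball 0 ρ) := differentiableOn_H1 s hρ2 hg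
  have hWB : ball (a ρ) (ρ / 8) ⊆ ball 0 ρ := ball_a_subset hρ
  have haW : a ρ ∈ ball (a ρ) (ρ / 8) := mem_ball_self (by positivity)
  have hreal : ∀ y : Fin 4 → ℝ, (fun i => (y i : ℂ)) ∈ ball (a ρ) (ρ / 8) →
      H1 s g (fun i => (y i : ℂ)) = 0 := by
    intro y hy
    obtain ⟨hrg, hne, hc, hf, h1⟩ := real_point hρ2 hy
    exact H1_eq_zero (hBU (hWB hy)) hne hc hf h1 (hagree _ hrg (hWB hy))
  have haW' : (fun i => (((fun _ => ρ / 4) : Fin 4 → ℝ) i : ℂ)) ∈ ball (a ρ) (ρ / 8) := haW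
  have hW0 : EqOn (H1 s g) 0 (ball (a ρ) (ρ / 8)) :=
    Literature.Analysis.Complex.AbhyankarJung.eqOn_zero_of_forall_real isOpen_ball
      (convex_ball _ _).isPreconnected (hH.mono hWB) hreal haW'
  have hHan : AnalyticOnNhd ℂ (H1 s g) (ball 0 ρ) :=
    Literature.Analysis.Complex.SCV.analyticOnNhd_of_differentiableOn hH isOpen_ball
  have hev : H1 s g =ᶠ[𝓝 (a ρ)] 0 :=
    Filter.eventuallyEq_of_mem (isOpen_ball.mem_nhds haW) hW0
  have hB0 : EqOn (H1 s g) 0 (ball 0 ρ) :=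
    hHan.eqOn_zero_of_preconnected_of_eventuallyEq_zero (convex_ball _ _).isPreconnected (hWB haW) hev
  have hcone : ∀ t : ℝ, t ≠ 0 → |t| < ρ → (D 1 (pv t) - D 0 (pv t)) / (t : ℂ) ^ 2 = 0 := by
    intro t ht0 ht
    have h := hB0 (pv_mem_ball hρ ht)
    rw [Pi.zero_apply, H1_pv] at h
    have hPhi : Phi (pv t) ≠ 0 := Phi_pv_ne_zero (by linarith)
    have ht4 : (t : ℂ) ^ 4 ≠ 0 := pow_ne_zero _ (ofReal_ne_zero.mpr ht0)
    have hD : D 1 (pv t) - D 0 (pv t) = 0 := by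
      rcases mul_eq_zero.mp h with h' | h'
      · exact absurd h' I_ne_zero
      · rcases mul_eq_zero.mp h' with h'' | h''
        · exact absurd h'' (mul_ne_zero hPhi ht4)
        · exact h''
    rw [hD, zero_div]
  have hlim0 : Tendsto (fun t : ℝ => (D 1 (pv t) - D 0 (pv t)) / (t : ℂ) ^ 2) (𝓝[≠] 0) (𝓝 0) := by
    refine tendsto_const_nhds.congr' ?_
    filter_upwards [eventually_lt hρ] with t ht
    exact (hcone t ht.1 ht.2).symm
  exact ell_ne_zero (tendsto_nhds_unique tendsto_cone hlim0)

/-! ## §3 Coordinate permutations fixing the bond direction: `A^N_i(p∘τ) = A^N_{τ(i)}(p)` -/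

/-- (plumbing) relabelling of the four momentum coordinates by a permutation `σ`: `(p∘σ)_j = p_{σ(j)}`.
[cite: FederbushWilliamson1987PhaseCellII, (1.4) p. 1416] -/
def perm (σ : Equiv.Perm (Fin 4)) (p : Momentum) : Momentum := fun j => p (σ j)

/-- (plumbing) `perm σ p j = p (σ j)`. [cite: FederbushWilliamson1987PhaseCellII, (1.4) p. 1416] -/
@[simp] theorem perm_apply (σ : Equiv.Perm (Fin 4)) (p : Momentum) (j : Fin 4) : perm σ p j = p (σ j) := rfl

/-- `p²` is permutation invariant. [cite: FederbushWilliamson1987PhaseCellII, (1.4) p. 1416] -/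
theorem csq_perm (σ : Equiv.Perm (Fin 4)) (p : Momentum) : csq (perm σ p) = csq p := by
  unfold csq
  exact Fintype.sum_equiv σ _ _ (fun j => rfl)

/-- `r_L` (1.7) is permutation invariant. [cite: FederbushWilliamson1987PhaseCellII, (1.7) p. 1416] -/
theorem rL_perm (σ : Equiv.Perm (Fin 4)) (p : Momentum) : rL (perm σ p) = rL p := by
  unfold rL
  congr 1
  exact Fintype.prod_equiv σ _ _ (fun k => rfl)

/-- (plumbing) shifting the relabelled momentum by `2πn` is relabelling the momentum shifted by `2π(n∘σ⁻¹)`.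
[cite: FederbushWilliamson1987PhaseCellII, (1.4) p. 1416] -/
theorem shift_perm (σ : Equiv.Perm (Fin 4)) (p : Momentum) (n : Fin 4 → ℤ) :
    shift (perm σ p) n = perm σ (shift p ((Equiv.arrowCongr σ (Equiv.refl ℤ)) n)) := by
  funext j
  simp [shift, perm, Equiv.arrowCongr_apply]

/-- **The bracket (1.4) is permutation covariant**: `⟨h⟩(p∘σ) = ⟨h∘(·∘σ)⟩(p)` — reindex the lattice sum `n ↦ n∘σ⁻¹`; the
weight `(1/(p+2πn)²)∏_i|(e^{ip_i}−1)/(p_i+2πn_i)|²` is symmetric in the four coordinates.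
[cite: FederbushWilliamson1987PhaseCellII, (1.4) p. 1416] -/
theorem bracket_perm (σ : Equiv.Perm (Fin 4)) (h : Momentum → ℂ) (p : Momentum) :
    bracket h (perm σ p) = bracket (fun q => h (perm σ q)) p := by
  set e : (Fin 4 → ℤ) ≃ (Fin 4 → ℤ) := Equiv.arrowCongr σ (Equiv.refl ℤ) with he
  unfold bracket
  conv_rhs => rw [← e.tsum_eq]
  refine tsum_congr fun n => ?_
  rw [shift_perm σ p n, csq_perm]
  have hprod : (∏ i, (exp (-I * perm σ p i) - 1) * (exp (I * perm σ p i) - 1) / (perm σ (shift p (e n)) i) ^ 2)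
      = ∏ i, (exp (-I * p i) - 1) * (exp (I * p i) - 1) / (shift p (e n) i) ^ 2 :=
    Fintype.prod_equiv σ _ _ (fun i => rfl)
  rw [hprod]

/-- `⟨1/p_j²⟩(p∘σ) = ⟨1/p_{σ(j)}²⟩(p)`. [cite: FederbushWilliamson1987PhaseCellII, (1.4) p. 1416, (1.17) p. 1417] -/
theorem invSqBracket_perm (σ : Equiv.Perm (Fin 4)) (j : Fin 4) (p : Momentum) :
    invSqBracket j (perm σ p) = invSqBracket (σ j) p := by
  unfold invSqBracket
  rw [bracket_perm]
  rfl

/-- The transposition `τ₃ = (2 3)` of print's coordinates (Lean `1 ↔ 2`), fixing the bond direction `1` (Lean `0`).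
[cite: FederbushWilliamson1987PhaseCellII, §I p. 1416 («the single unit bond in the +1 direction»)] -/
def τ₃ : Equiv.Perm (Fin 4) := Equiv.swap 1 2

/-- The transposition `τ₄ = (2 4)` of print's coordinates (Lean `1 ↔ 3`), fixing the bond direction.
[cite: FederbushWilliamson1987PhaseCellII, §I p. 1416] -/
def τ₄ : Equiv.Perm (Fin 4) := Equiv.swap 1 3

/-- (plumbing) [cite: FederbushWilliamson1987PhaseCellII, §I p. 1416] -/
@[simp] theorem τ₃_zero : τ₃ 0 = 0 := by decide
/-- (plumbing) [cite: FederbushWilliamson1987PhaseCellII, §I p. 1416] -/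
@[simp] theorem τ₃_one : τ₃ 1 = 2 := by decide
/-- (plumbing) [cite: FederbushWilliamson1987PhaseCellII, §I p. 1416] -/
@[simp] theorem τ₃_two : τ₃ 2 = 1 := by decide
/-- (plumbing) [cite: FederbushWilliamson1987PhaseCellII, §I p. 1416] -/
@[simp] theorem τ₃_three : τ₃ 3 = 3 := by decide
/-- (plumbing) [cite: FederbushWilliamson1987PhaseCellII, §I p. 1416] -/
@[simp] theorem τ₄_zero : τ₄ 0 = 0 := by decide
/-- (plumbing) [cite: FederbushWilliamson1987PhaseCellII, §I p. 1416] -/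
@[simp] theorem τ₄_one : τ₄ 1 = 3 := by decide
/-- (plumbing) [cite: FederbushWilliamson1987PhaseCellII, §I p. 1416] -/
@[simp] theorem τ₄_two : τ₄ 2 = 2 := by decide
/-- (plumbing) [cite: FederbushWilliamson1987PhaseCellII, §I p. 1416] -/
@[simp] theorem τ₄_three : τ₄ 3 = 1 := by decide

/-- **`A^N_3(p∘τ₃) = A^N_2(p)`**: the formula (2.1)–(2.5) is covariant under the transposition of print's coordinates 2, 3
(`r_L`, `f̄₁`, `p²`, `𝒟`, `⟨1/p₁²⟩` are invariant; `l₃(p∘τ₃) = l₂(p)`). [cite: FederbushWilliamson1987PhaseCellII, (2.1)–(2.5)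
p. 1417] -/
theorem AN_two_perm (s : ℕ) (p : Momentum) : AN s 2 (perm τ₃ p) = AN s 1 p := by
  unfold AN Aprime X fbar
  rw [scrD_expand, scrD_expand, ModeAnalyticityGaugeRepair.l_two, ModeAnalyticityGaugeRepair.l_one, rL_perm, csq_perm]
  simp only [invSqBracket_perm, perm_apply, τ₃_zero, τ₃_one, τ₃_two, τ₃_three]
  ring

/-- **`A^N_4(p∘τ₄) = A^N_2(p)`**, idem for print's coordinates 2, 4. [cite: FederbushWilliamson1987PhaseCellII, (2.1)–(2.5)
p. 1417] -/
theorem AN_three_perm (s : ℕ) (p : Momentum) : AN s 3 (perm τ₄ p) = AN s 1 p := by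
  unfold AN Aprime X fbar
  rw [scrD_expand, scrD_expand, ModeAnalyticityGaugeRepair.l_three, ModeAnalyticityGaugeRepair.l_one, rL_perm, csq_perm]
  simp only [invSqBracket_perm, perm_apply, τ₄_zero, τ₄_one, τ₄_two, τ₄_three]
  ring

/-- (plumbing) relabelling preserves the balls `‖p‖ < ρ` (sup norm). [cite: FederbushWilliamson1987PhaseCellII, (3.2) p. 1417] -/
theorem perm_mem_ball (σ : Equiv.Perm (Fin 4)) {ρ : ℝ} {p : Momentum} (hp : p ∈ ball (0 : Momentum) ρ) :
    perm σ p ∈ ball (0 : Momentum) ρ := by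
  have hρ : 0 < ρ := pos_of_mem_ball hp
  rw [mem_ball_zero_iff, pi_norm_lt_iff hρ] at hp ⊢
  exact fun j => hp (σ j)

/-- (plumbing) relabelling preserves the real generic momenta. [cite: FederbushWilliamson1987PhaseCellII, §I–§II p. 1416–1417] -/
theorem perm_mem_realGeneric (σ : Equiv.Perm (Fin 4)) {p : Momentum} (hp : p ∈ realGeneric) :
    perm σ p ∈ realGeneric := fun j => hp (σ j)

/-- (plumbing) relabelling is `ℂ`-differentiable (it is linear). [folklore] -/
private theorem differentiable_perm (σ : Equiv.Perm (Fin 4)) : Differentiable ℂ (perm σ) :=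
  differentiable_pi.mpr fun j => differentiable_apply (σ j)

/-- **Transport.** If `A^N_i(p∘τ) = A^N_2(p)` identically, a holomorphic `g` agreeing with `A^N_i` at the real generic momenta
of a ball yields `g∘(·∘τ)` agreeing with `A^N_2` there — impossible by `no_holomorphic_extension_one`.
[cite: FederbushWilliamson1987PhaseCellII, Theorem 3.1 p. 1417] -/
theorem no_holomorphic_extension_of_perm (s : ℕ) {τ : Equiv.Perm (Fin 4)} {i : Fin 4}
    (hAN : ∀ p, AN s i (perm τ p) = AN s 1 p) {ρ : ℝ} (hρ : 0 < ρ) (hρ2 : ρ ≤ 1 / 2) {g : Momentum → ℂ}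
    (hg : DifferentiableOn ℂ g (ball 0 ρ))
    (hagree : ∀ p ∈ realGeneric, p ∈ ball (0 : Momentum) ρ → g p = AN s i p) : False := by
  refine no_holomorphic_extension_one s hρ hρ2 (g := fun p => g (perm τ p)) ?_ ?_
  · exact hg.comp (differentiable_perm τ).differentiableOn fun p hp => perm_mem_ball τ hp
  · intro p hp hb
    show g (perm τ p) = AN s 1 p
    rw [hagree _ (perm_mem_realGeneric τ hp) (perm_mem_ball τ hb), hAN]

/-! ## §4 All components -/

/-- **Core of the refutation, every component.** For every `s` and every `i`, no function holomorphic on a ball `‖p‖ < ρ`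
(`0 < ρ ≤ 1/2`) agrees with the typed mode `A^N_i = ModeAnalyticity.AN s i` of (2.4) at the real generic momenta of that ball:
every component of print's `A^N` has a pole along the complex light cone `p² = 0` through `p = 0` (component 1: p04
`ModeAnalyticityThm31Refutation.no_holomorphic_extension`; component 2: `no_holomorphic_extension_one`; components 3, 4 by
the coordinate transpositions `τ₃`, `τ₄`). [cite: FederbushWilliamson1987PhaseCellII, Theorem 3.1 p. 1417, (2.1)–(2.5) p. 1417,
(5.5), (6.11)–(6.14) p. 1418] -/
theorem no_holomorphic_extension_all (s : ℕ) (i : Fin 4) {ρ : ℝ} (hρ : 0 < ρ) (hρ2 : ρ ≤ 1 / 2) {g : Momentum → ℂ}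
    (hg : DifferentiableOn ℂ g (ball 0 ρ))
    (hagree : ∀ p ∈ realGeneric, p ∈ ball (0 : Momentum) ρ → g p = AN s i p) : False := by
  fin_cases i
  · exact no_holomorphic_extension s hρ hρ2 hg hagree
  · exact no_holomorphic_extension_one s hρ hρ2 hg hagree
  · exact no_holomorphic_extension_of_perm s (AN_two_perm s) hρ hρ2 hg hagree
  · exact no_holomorphic_extension_of_perm s (AN_three_perm s) hρ hρ2 hg hagree

/-- **Theorem 3.1 of [FederbushWilliamson1987PhaseCellII] is false as typed, for EVERY component `i` and every `s`.**
[cite: FederbushWilliamson1987PhaseCellII, Theorem 3.1 (3.2) p. 1417] -/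
theorem not_theorem31_all (s : ℕ) (i : Fin 4) : ¬ Theorem31 s i := by
  rintro ⟨ε₀, hε₀, g, hg, hagree⟩
  set ρ := min ε₀ (1 / 2) with hρdef
  have hρ : 0 < ρ := lt_min hε₀ (by norm_num)
  have hρ2 : ρ ≤ 1 / 2 := min_le_right _ _
  have hsub : ball (0 : Momentum) ρ ⊆ DL ε₀ := ball_subset_DL hρ hρ2 (min_le_left _ _)
  exact no_holomorphic_extension_all s i hρ hρ2 ((hg.mono hsub).differentiableOn) (fun p hp _ => hagree p hp)

/-- **Theorem 3.2 is false as typed, for every component `i` and every `s`.**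
[cite: FederbushWilliamson1987PhaseCellII, Theorem 3.2 (3.3) p. 1417] -/
theorem not_theorem32_all (s : ℕ) (i : Fin 4) : ¬ Theorem32 s i := by
  rintro ⟨ε₀, hε₀, g, hg, hagree⟩
  set ρ := min ε₀ (1 / 2) with hρdef
  have hρ : 0 < ρ := lt_min hε₀ (by norm_num)
  have hρ2 : ρ ≤ 1 / 2 := min_le_right _ _
  have hsub : ball (0 : Momentum) ρ ⊆ DG ε₀ := ball_subset_DG hρ (min_le_left _ _)
  exact no_holomorphic_extension_all s i hρ hρ2 ((hg.mono hsub).differentiableOn) (fun p hp _ => hagree p hp)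

/-- **Theorem 3.3 is false as typed, for every component `i` and every `s`.**
[cite: FederbushWilliamson1987PhaseCellII, Theorem 3.3 (3.4)–(3.5) p. 1417] -/
theorem not_theorem33_all (s : ℕ) (i : Fin 4) : ¬ Theorem33 s i := by
  rintro ⟨ε₀, hε₀, g, hg, hagree, -⟩
  exact not_theorem32_all s i ⟨ε₀, hε₀, g, hg, hagree⟩

/-! ## §5 I (3.13) for print's `A^N`, every component -/

open PrintedModeNoDecay in
/-- **NO EXPONENTIALLY DECAYING CONTINUOUS FIELD HAS PRINT'S `A^N_i` AS ITS TRANSFORM NEAR `p = 0`, for any component `i`.**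
For every `s`, `i`, every continuous `f : ℝ⁴ → ℂ` with `‖f(x)‖ ≤ ce^{−γ|x|}` (`γ > 0`), every convention `κ ∈ ℂ`, `σ ∈ ℝ` and every
radius `ρ > 0`, the identity `κ·∫e^{iσ x·p}f(x)d⁴x = A^N_i(p)` cannot hold for all real generic momenta `p` with `‖p‖ < ρ`
(r17 gen 13 `PrintedModeNoDecay.differentiableOn_laplaceFT` + `no_holomorphic_extension_all`).
[cite: Federbush1986PhaseCellI, (3.13) p. 328; FederbushWilliamson1987PhaseCellII, (2.4)–(2.5), Theorem 3.1 p. 1417] -/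
theorem no_decaying_field_with_printed_transform_all (s : ℕ) (i : Fin 4) {f : E4 → ℂ} {c γ : ℝ} (hγ : 0 < γ)
    (hf : Continuous f) (hdec : ∀ x, ‖f x‖ ≤ c * Real.exp (-γ * ‖x‖)) (κ : ℂ) (σ : ℝ) {ρ : ℝ} (hρ : 0 < ρ)
    (hagree : ∀ p ∈ realGeneric, p ∈ ball (0 : Momentum) ρ → κ * laplaceFT σ f p = AN s i p) : False := by
  set ρ' : ℝ := min ρ (min (1 / 2) (γ / (8 * (|σ| + 1)))) with hρ'
  have hσ1 : 0 < |σ| + 1 := by positivity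
  have hρ'pos : 0 < ρ' := lt_min hρ (lt_min one_half_pos (div_pos hγ (by positivity)))
  have hρ'half : ρ' ≤ 1 / 2 := (min_le_right _ _).trans (min_le_left _ _)
  have hρ'ρ : ρ' ≤ ρ := min_le_left _ _
  have hσρ : 8 * |σ| * ρ' ≤ γ := by
    have h1 : ρ' ≤ γ / (8 * (|σ| + 1)) := (min_le_right _ _).trans (min_le_right _ _)
    calc 8 * |σ| * ρ' ≤ 8 * (|σ| + 1) * ρ' := mul_le_mul_of_nonneg_right (by linarith) hρ'pos.le
      _ ≤ 8 * (|σ| + 1) * (γ / (8 * (|σ| + 1))) := mul_le_mul_of_nonneg_left h1 (by positivity)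
      _ = γ := by field_simp
  have hg : DifferentiableOn ℂ (fun p => κ * laplaceFT σ f p) (ball (0 : Momentum) ρ') :=
    (differentiableOn_laplaceFT hγ hf hdec hσρ).const_mul κ
  exact no_holomorphic_extension_all s i hρ'pos hρ'half hg fun p hp hb => hagree p hp (ball_subset_ball hρ'ρ hb)

open PrintedModeNoDecay in
/-- **I (3.13) FAILS FOR PRINT'S `A^N` (Part II's printed gauge), EVERY component `μ`.**  No field `B : ℝ⁴ → ℝ⁴` carrying the
typed decay package `AbelianAveraging.Decay313to315 B` has a component `μ` whose Fourier–Laplace transform (any convention `κ`, `σ`)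
reproduces `A^N_μ = AN s μ` on the real generic momenta near `p = 0`.  (r17 gen 13 `not_decay313_of_printed_transform` was the case
`μ = 1`; the located repair is p04's corrected gauge, `CorrectedModePlaquetteVariables.decay313to315_field`.)
[cite: Federbush1986PhaseCellI, (3.13)–(3.15) p. 328; FederbushWilliamson1987PhaseCellII, (2.4)–(2.5) p. 1417] -/
theorem not_decay313_of_printed_transform_all (s : ℕ) (μ : Fin 4) {B : E4 → Fin 4 → ℝ}
    (hB : AbelianAveraging.Decay313to315 B) (κ : ℂ) (σ : ℝ) {ρ : ℝ} (hρ : 0 < ρ)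
    (hagree : ∀ p ∈ realGeneric, p ∈ ball (0 : Momentum) ρ →
      κ * laplaceFT σ (fun x => ((B x μ : ℝ) : ℂ)) p = AN s μ p) : False := by
  obtain ⟨c, -, γ, hγ, -, hC1, h313, -, -⟩ := hB
  have hcont : Continuous fun x : E4 => ((B x μ : ℝ) : ℂ) :=
    Complex.continuous_ofReal.comp ((continuous_apply μ).comp hC1.continuous)
  refine no_decaying_field_with_printed_transform_all s μ hγ hcont (c := c) (fun x => ?_) κ σ hρ hagree
  rw [Complex.norm_real, Real.norm_eq_abs]
  exact (h313 x μ).le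

end ModeAnalyticityThm31RefutationAll

end Literature.MathematicalPhysics.QuantumFieldTheory.Federbush1986
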